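import Literature.AnabelianGeometry.EtaleTheta.FrobenioidEnvelopeIso
import Mathlib.CategoryTheory.SingleObj
import Mathlib.GroupTheory.SpecificGroups.Alternating

/-!
# [EtTh] §5 / §2: CLOSED toy data of type `ThetaFrobenioid` and `ThetaEnvData` (witness material for the §5 schemata, pp. 322–333 / PDF pp. 96–107)

Mochizuki, *The étale theta function and its Frobenioid-theoretic manifestations*, Publ. RIMS **45**
(2009), §5 pp.322–333 (PDF pp.96–107) [cite: MochizukiEtTh2009, §5 p.330–332 (PDF pp.104–106)].  abc-iut
cell, block F (fact-proving wave), seat abc-iut-f-120.  WITNESS DATA next to abc-iut-L2-t4's FROZEN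
`FrobenioidTheta.lean` / `FrobenioidMonoTheta.lean` / `FrobenioidEnvelopeIso.lean` and abc-iut-L2-t2's
`MonoThetaEnv.lean` (nothing landed is edited; no `Prop` fact, no instance, no notation).  Consumed by the
negative file `FrobenioidMonoThetaSchemaNegative.lean` (FACT-LIST rows F-0533 / F-0534 / F-0535 / F-1307).

WHY.  The §5 named facts of the FACT-LIST are PARAMETRISED predicates over ABSTRACT §5 data
`𝔉 : ThetaFrobenioid C D` — a `structure` of DATA fields ("NOTHING asserts that such data exist",
`FrobenioidTheta.lean`).  Until 2026-08-26 no CLOSED term of that type existed in the tree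
(`Discharge/Sec5VocabRecordsNonVacuity.lean`: "No landed `ThetaFrobenioid` is a closed term"); the first one is
abc-iut-f-115's degenerate datum `Sec5Toy.datum` (`Discharge/Sec5DegenerateDatum.lean`, base `Discrete PUnit`:
ALL automorphism groups trivial, `Facts` holds) — enough for the Π-side schemata, but the Aut-side schemata
(non-abelian `Aut_C(B_N)`, non-torsion units, cyclotomes MOVED by conjugation: F-0534 / F-0535 / F-1307) need
data with non-trivial automorphism groups and units.  This file supplies a CONSTRUCTOR of such closed toy §5
data and one closed toy §2 datum (v2: docstring-only correction of v1's "no closed term existed" sentence;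
declarations byte-identical):

* `Toy.Pi := ℤ × ℤ × 𝔖₃` (discrete) with `Π ↠ ℤ` the first coordinate (`zq`, §5 side: `Π^tp_Y̲ = Ker`),
  resp. the second (`zq'`, §2 side), and `Π^tp_Ÿ̲ := Ker ∩ s3⁻¹(𝔄₃)` of relative index `2`
  (`piYdd_relIndex`, from `alternatingGroup.index_eq_two`);
* `Toy.pre π` / `Toy.stub` / **`Toy.frd`**: for groups `G`, `H`, a homomorphism `π : G → H` with abelian
  kernel, `C := BG`, `D := BH` the one-object categories (`CategoryTheory.SingleObj`), base functor
  `π.toFunctor`, trivial divisor monoids and Frobenius degrees (so `O^×(S)` = the `Ker π`-automorphisms,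
  `mem_unitsSubgroup_pre_iff`), `A_⊚ = A_N = B_N = ⋆`, `s^⊓_N = s^⊔_N = id`, `ρ := (H ⥲ Aut ⋆) ∘ ρ₀` for a
  surjection `ρ₀ : Π ↠ H`, `s^trv_N = s^⊓-gp_N = s^⊔-gp_N` induced by a homomorphism `σ : H → G`, birational
  units `B` with an injective `υ : O^× → B`, constants `c : K^× ↪ B`, `Θ̈ := 1` — every field of
  `ThetaFrobenioid` is met (`Toy.frd` elaborates with no `sorry`);
* `Toy.env N μ`: a §2 datum (`ThetaEnvData N`) over the same `Π` with `Π^tp_Y := Ker(zq')`, trivial Galois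
  group, a cyclic `μ` of order `N` with trivial character and the single trivial theta cocycle;
* `Toy.autEquiv : G ⥲ Aut(⋆)`, `Toy.homOf : Aut(S) → G` (`a ↦ a.hom`, injective) for computing in `Aut_C(B_N)`.

HONEST FRAMING: toy data exhibiting the CONSISTENCY and the SLACK of the typed interface; they say nothing
about the genuine curve data of [EtTh] (a refereed paper), nothing about [IUTchIII] Cor. 3.12, and take no
side; typed ≠ proved.
-/

namespace Literature.AnabelianGeometry.EtaleTheta

open CategoryTheory
open Literature.AlgebraicGeometry.Frobenioids

namespace ThetaFrobenioid

namespace Toy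

/-! ### The toy tempered groups `Π := ℤ × ℤ × 𝔖₃` -/

/-- The toy `Π^tp_X̲ := ℤ × ℤ × 𝔖₃` (discrete). [folklore] -/
abbrev Pi : Type := Multiplicative ℤ × (Multiplicative ℤ × Equiv.Perm (Fin 3))

/-- The toy `Π^tp_X̲ ↠ l·ℤ` of the §5 side: the FIRST `ℤ`-coordinate. [folklore] -/
abbrev zq : Pi →* Multiplicative ℤ := MonoidHom.fst _ _

/-- The toy `Π^tp_X ↠ Gal(Y/X) ≅ ℤ` of the §2 side: the SECOND `ℤ`-coordinate. [folklore] -/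
abbrev zq' : Pi →* Multiplicative ℤ := (MonoidHom.fst _ _).comp (MonoidHom.snd _ _)

/-- The projection `Π ↠ 𝔖₃`. [folklore] -/
abbrev s3 : Pi →* Equiv.Perm (Fin 3) := (MonoidHom.snd _ _).comp (MonoidHom.snd _ _)

/-- The toy `Π^tp_Ÿ̲ := Ker(Π ↠ ℤ) ∩ s3⁻¹(𝔄₃)` of the §5 side. [folklore] -/
abbrev piYdd : Subgroup Pi := (alternatingGroup (Fin 3)).comap s3 ⊓ zq.ker

/-- The toy `Π^tp_Ÿ := Ker(Π ↠ ℤ)' ∩ s3⁻¹(𝔄₃)` of the §2 side. [folklore] -/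
abbrev piYdd' : Subgroup Pi := (alternatingGroup (Fin 3)).comap s3 ⊓ zq'.ker

/-- `Π ↠ ℤ` is onto. [folklore] -/
private theorem zq_surjective : Function.Surjective zq := fun z => ⟨(z, 1), rfl⟩

/-- `Π ↠ ℤ'` is onto. [folklore] -/
private theorem zq'_surjective : Function.Surjective zq' := fun z => ⟨(1, (z, 1)), rfl⟩

/-- `Ker(Π ↠ ℤ)` projects onto `𝔖₃`. [folklore] -/
private theorem map_s3_ker_zq : (zq.ker).map s3 = ⊤ :=
  top_unique fun σ _ => ⟨(1, (1, σ)), MonoidHom.mem_ker.mpr rfl, rfl⟩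

/-- `Ker(Π ↠ ℤ')` projects onto `𝔖₃`. [folklore] -/
private theorem map_s3_ker_zq' : (zq'.ker).map s3 = ⊤ :=
  top_unique fun σ _ => ⟨(1, (1, σ)), MonoidHom.mem_ker.mpr rfl, rfl⟩

/-- `[Ker(Π ↠ ℤ) : Π^tp_Ÿ̲] = [𝔖₃ : 𝔄₃] = 2`. [folklore] -/
private theorem piYdd_relIndex : piYdd.relIndex zq.ker = 2 := by
  rw [Subgroup.inf_relIndex_right, Subgroup.relIndex_comap, map_s3_ker_zq, Subgroup.relIndex_top_right]
  exact alternatingGroup.index_eq_two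

/-- `[Ker(Π ↠ ℤ') : Π^tp_Ÿ] = [𝔖₃ : 𝔄₃] = 2`. [folklore] -/
private theorem piYdd'_relIndex : piYdd'.relIndex zq'.ker = 2 := by
  rw [Subgroup.inf_relIndex_right, Subgroup.relIndex_comap, map_s3_ker_zq', Subgroup.relIndex_top_right]
  exact alternatingGroup.index_eq_two

/-! ### Automorphisms of the one-object category of a group -/

/-- `G ⥲ Aut(⋆)` in the one-object category `SingleObj G`. [folklore] -/
def autEquiv (G : Type) [Group G] : G ≃* Aut (SingleObj.star G) := toUnits.trans (Units.toAut G)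

/-- `Aut(S) → G`, `a ↦ a.hom` (every object of `SingleObj G` has endomorphism monoid `G`). [folklore] -/
def homOf (G : Type) [Group G] (S : SingleObj G) : Aut S →* G where
  toFun a := a.hom
  map_one' := rfl
  map_mul' _ _ := rfl

/-- `a ↦ a.hom` is injective (plumbing for computing in `Aut_C(B_N)` of the toy data).
[cite: MochizukiEtTh2009, §5 p.331 (PDF p.105)] -/
theorem homOf_injective (G : Type) [Group G] (S : SingleObj G) : Function.Injective (homOf G S) :=
  fun _ _ h => Aut.ext h

/-- `homOf ∘ autEquiv = id` (plumbing for computing in `Aut_C(B_N)` of the toy data).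
[cite: MochizukiEtTh2009, §5 p.331 (PDF p.105)] -/
@[simp] theorem homOf_autEquiv (G : Type) [Group G] (g : G) :
    homOf G (SingleObj.star G) (autEquiv G g) = g := rfl

/-! ### The toy pre-Frobenioid data and §5 stubs -/

variable {G H : Type} [Group G] [Group H]

/-- Toy `(Base, Div, deg_Fr)`: base functor induced by `π : G → H`, trivial divisor monoids, all
Frobenius degrees `1`. [folklore] -/
def pre (π : G →* H) : PreFrobenioidData.{0} (SingleObj G) (SingleObj H) where
  base := π.toFunctor
  Mon := fun _ => PUnit
  pull := fun _ => MonoidHom.id _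
  pull_id := fun _ _ => rfl
  pull_comp := fun _ _ _ => rfl
  div := fun _ => PUnit.unit
  degFr := fun _ => 1
  div_id := fun _ => rfl
  div_comp := fun _ _ => rfl
  degFr_id := fun _ => rfl
  degFr_comp := fun _ _ => (mul_one 1).symm

/-- `O^×(S)` of the toy data ([FrdI] Def. 1.2 (ii): base-identity linear automorphisms; "`O^×(B_N)`",
p.331): exactly the automorphisms over the kernel of `π`.  [cite: MochizukiEtTh2009, §5 p.331 (PDF p.105)] -/
theorem mem_unitsSubgroup_pre_iff (π : G →* H) (S : SingleObj G) (u : Aut S) :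
    u ∈ (pre π).unitsSubgroup S ↔ π (homOf G S u) = 1 :=
  ⟨fun h => h.1, fun h => ⟨h, rfl⟩⟩

/-- `O^×(S) → B` induced by a homomorphism `j : G → B`. [folklore] -/
def unitsHomOf (π : G →* H) (B : Type) [CommGroup B] (j : G →* B) (S : SingleObj G) :
    (pre π).unitsSubgroup S →* B :=
  j.comp ((homOf G S).comp ((pre π).unitsSubgroup S).subtype)

/-- "`O^×(B_N) ↪ O^×(B_N^birat)`" is injective for the toy data as soon as `j` is injective on `Ker π`.
[cite: MochizukiEtTh2009, Lem 5.8 p.331 (PDF p.105)] -/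
theorem unitsHomOf_injective (π : G →* H) (B : Type) [CommGroup B] (j : G →* B)
    (hj : Set.InjOn j {a | π a = 1}) (S : SingleObj G) : Function.Injective (unitsHomOf π B j S) :=
  fun a b h => Subtype.ext (homOf_injective G S (hj ((mem_unitsSubgroup_pre_iff π S _).mp a.2)
    ((mem_unitsSubgroup_pre_iff π S _).mp b.2) h))

/-- Toy tempered-Frobenioid stub: units `= Ker π`-automorphisms (abelian by `hcomm`), birational units
`B` with an injective `υ : O^× → B`. [folklore] -/
def stub (π : G →* H) (hcomm : ∀ a b : G, π a = 1 → π b = 1 → a * b = b * a)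
    (B : Type) [CommGroup B] (υ : ∀ S : SingleObj G, (pre π).unitsSubgroup S →* B)
    (hυ : ∀ S, Function.Injective (υ S)) :
    FrobenioidTheta.TemperedFrobenioidStub.{0} (SingleObj G) (SingleObj H) where
  pre := pre π
  units_comm S := ⟨⟨fun a b => Subtype.ext (homOf_injective G S (by
    change homOf G S a.1 * homOf G S b.1 = homOf G S b.1 * homOf G S a.1
    exact hcomm _ _ ((mem_unitsSubgroup_pre_iff π S _).mp a.2)
      ((mem_unitsSubgroup_pre_iff π S _).mp b.2)))⟩⟩
  biratUnits := fun _ => B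
  unitsToBirat := υ
  unitsToBirat_injective := hυ
  unitsPull := fun _ => 1
  IsBaseFrobeniusType := ⊤

/-- Toy §5 data over `π : G → H` (units = kernel, assumed abelian), a homomorphism `σ : H → G` feeding
`s^trv_N, s^⊓-gp_N, s^⊔-gp_N`, a surjection `ρ₀ : Π ↠ H` feeding `ρ`, level `N`, constants `c : K^× ↪ B`.
[folklore] -/
abbrev frd (π : G →* H) (hcomm : ∀ a b : G, π a = 1 → π b = 1 → a * b = b * a)
    (B : Type) [CommGroup B] (υ : ∀ S : SingleObj G, (pre π).unitsSubgroup S →* B)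
    (hυ : ∀ S, Function.Injective (υ S))
    (σ : H →* G) (ρ₀ : Pi →* H) (hρ₀ : Function.Surjective ρ₀) (N : ℕ+)
    (K : Type) [Field K] (c : Kˣ →* B) (hc : Function.Injective c) :
    ThetaFrobenioid.{0} (SingleObj G) (SingleObj H) where
  toTemperedFrobenioidStub := stub π hcomm B υ hυ
  lDelta := fun _ => PUnit
  lDeltaMap := fun _ => 1
  l := 1
  odd_l := odd_one
  N := N
  Acirc := SingleObj.star G
  AN := SingleObj.star G
  BN := SingleObj.star G
  sCap := 𝟙 _
  sCup := 𝟙 _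
  base_map_sCap := rfl
  isPreStep_sCap := ⟨rfl, show IsIso ((pre π).base.map (𝟙 _)) from inferInstance⟩
  isPreStep_sCup := ⟨rfl, show IsIso ((pre π).base.map (𝟙 _)) from inferInstance⟩
  PiX := Pi
  instTopPiX := ⊥
  instTopGroupPiX := by
    letI : TopologicalSpace Pi := ⊥
    haveI : DiscreteTopology Pi := ⟨rfl⟩
    infer_instance
  zquot := zq
  zquot_surjective := zq_surjective
  PiYdd := piYdd
  PiYdd_le := inf_le_right
  relindex_PiYdd := piYdd_relIndex
  PiYdd_normal := inferInstance
  isOpen_PiYdd := by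
    letI : TopologicalSpace Pi := ⊥
    haveI : DiscreteTopology Pi := ⟨rfl⟩
    exact isOpen_discrete _
  ρ := (autEquiv H).toMonoidHom.comp ρ₀
  ρ_surjective := (autEquiv H).surjective.comp hρ₀
  isOpen_ker_ρ := by
    letI : TopologicalSpace Pi := ⊥
    haveI : DiscreteTopology Pi := ⟨rfl⟩
    exact isOpen_discrete _
  strv := (autEquiv G).toMonoidHom.comp (σ.comp (autEquiv H).symm.toMonoidHom)
  sgpCap := (autEquiv G).toMonoidHom.comp (σ.comp (autEquiv H).symm.toMonoidHom)
  sgpCup := ((autEquiv G).toMonoidHom.comp (σ.comp (autEquiv H).symm.toMonoidHom)).comp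
    (Subgroup.subtype _)
  K := K
  constEmb := c
  constEmb_injective := hc
  thetaFn := 1

section FrdLemmas

variable (π : G →* H) (hcomm : ∀ a b : G, π a = 1 → π b = 1 → a * b = b * a)
    (B : Type) [CommGroup B] (υ : ∀ S : SingleObj G, (pre π).unitsSubgroup S →* B)
    (hυ : ∀ S, Function.Injective (υ S))
    (σ : H →* G) (ρ₀ : Pi →* H) (hρ₀ : Function.Surjective ρ₀) (N : ℕ+)
    (K : Type) [Field K] (c : Kˣ →* B) (hc : Function.Injective c)

/-- `O^×(B_N)` of the toy §5 data: automorphisms over `Ker π`. [cite: MochizukiEtTh2009, §5 p.331 (PDF p.105)] -/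
theorem mem_units_frd_iff (u : Aut (frd π hcomm B υ hυ σ ρ₀ hρ₀ N K c hc).BN) :
    u ∈ (frd π hcomm B υ hυ σ ρ₀ hρ₀ N K c hc).units (frd π hcomm B υ hυ σ ρ₀ hρ₀ N K c hc).BN ↔
      π (homOf G _ u) = 1 :=
  mem_unitsSubgroup_pre_iff π _ u

/-- `s^⊓-gp_N(ρ x)` of the toy data is the automorphism `σ(ρ₀ x)` ("the composite of the natural outer
homomorphism `Π^tp_X ↠ Aut_D(B_N^bs)` with `s^⊓-gp_N`", p.332).  [cite: MochizukiEtTh2009, Lem 5.9 (iii) p.332 (PDF p.106)] -/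
@[simp] theorem homOf_sgpCap_rho (x : Pi) :
    homOf G _ ((frd π hcomm B υ hυ σ ρ₀ hρ₀ N K c hc).sgpCap
      ((frd π hcomm B υ hυ σ ρ₀ hρ₀ N K c hc).ρ x)) = σ (ρ₀ x) := by
  change homOf G _ (autEquiv G (σ ((autEquiv H).symm (autEquiv H (ρ₀ x))))) = _
  rw [MulEquiv.symm_apply_apply, homOf_autEquiv]

end FrdLemmas

/-! ### A toy §2 datum over the same `Π` -/

/-- Toy §2 data (`ThetaEnvData`): `Π^tp_X := ℤ × ℤ × 𝔖₃` with `Π^tp_Y := Ker` of the SECOND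
`ℤ`-coordinate, `Π^tp_Ÿ := Π^tp_Y ∩ s3⁻¹(𝔄₃)`, trivial Galois group, a cyclic group `μ` of order `N` with
trivial character, and the single (trivial) theta cocycle.  [folklore] -/
noncomputable def env (N : ℕ+) (μ : Type) [CommGroup μ] [Fintype μ] (hcyc : IsCyclic μ)
    (hcard : Fintype.card μ = N) : ThetaEnvData.{0} N where
  PiX := Pi
  topPiX := ⊥
  tgPiX := by
    letI : TopologicalSpace Pi := ⊥
    haveI : DiscreteTopology Pi := ⟨rfl⟩
    infer_instance
  G := Unit
  aug := 1
  aug_surjective := fun _ => ⟨1, Subsingleton.elim _ _⟩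
  PiY := zq'.ker
  PiY_normal := inferInstance
  PiY_open := by
    letI : TopologicalSpace Pi := ⊥
    haveI : DiscreteTopology Pi := ⟨rfl⟩
    exact isOpen_discrete _
  galYX := QuotientGroup.quotientKerEquivOfSurjective zq' zq'_surjective
  PiYdd := piYdd'
  PiYdd_le := inf_le_right
  PiYdd_normal := inferInstance
  PiYdd_open := by
    letI : TopologicalSpace Pi := ⊥
    haveI : DiscreteTopology Pi := ⟨rfl⟩
    exact isOpen_discrete _
  index_PiYdd := piYdd'_relIndex
  mu := μ
  topMu := ⊥
  discMu := @DiscreteTopology.mk μ ⊥ rfl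
  mu_cyclic := hcyc
  card_mu := hcard
  chi := 1
  chi_ker_open := by
    letI : TopologicalSpace Pi := ⊥
    haveI : DiscreteTopology Pi := ⟨rfl⟩
    exact isOpen_discrete _
  thetaCocycles := {1}
  thetaCocycles_nonempty := ⟨1, rfl⟩
  isCocycle := by
    rintro η rfl g h
    simp
  locallyConstant := by
    letI : TopologicalSpace Pi := ⊥
    rintro η rfl
    exact IsLocallyConstant.const 1
  mul_coboundary_mem := by
    rintro η rfl x
    show _ = _
    funext g
    simp [CycEnvelope.coboundary]

end Toy

end ThetaFrobenioid

end Literature.AnabelianGeometry.EtaleTheta
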